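import Summits.BirchSwinnertonDyer.BirchSwinnertonDyer.Theorems.SprungSharpFlatMainConjecture
import Summits.BirchSwinnertonDyer.BirchSwinnertonDyer.Theorems.ThetaPartnerAtTwoSignedKatoUpToAtTwoInvolFunctionalEquation
import Literature.NumberTheory.EllipticCurves.Sprung2012.SharpFlatSelmerDualInvolutionTwistProofs
import Literature.NumberTheory.EllipticCurves.MazurTateFiniteLevelFunctionalEquationProofs
import HarnessLib

/-!
# Crux `SprungLowerDivisibilityAtThree` (stmt-BirchSwinnertonDyer-19875, K1), line `chromatic-common-zeros` —
# THE KEYING DOOR: what the typed leaf `Theorems.SprungSharpFlatLowerDivisibility W p •` says about the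
# CONTRAGREDIENT (key `γ⁻¹`) dual `X^•`, and what the re-keyed leaf C′ says about the tree-keyed (key `γ`) dual —
# in the kernel, with no named fact

Width seat `cruxlead-stmt-BirchSwinnertonDyer-19875-w3` gen 8 (prover; D-0154 KEY (146)/(147)(a) row 8; host
`pub/bsd-ssimc`). THEOREMS ONLY — no definition, no named fact, no `instance`, no `sorry`; route-independent (no
`Theses` import); closes no item; **BSD is NOT proved, K1 is NOT proved, nothing about nature is asserted.**

## Why this file (LEAD g5 memo `Cruxes/SprungLowerDivisibilityAtThree/Lines/chromatic-common-zeros-KEYING-g5.md`)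

The K1 leaf binds the ♯/♭ dual as `D : Sprung2012.SharpFlatSelmerDualData W κ γ …` — key `γ`: `1 + T` acts on
`Hom(Sel^•, ℚ/ℤ)` by PRE-composition `x ↦ x ∘ conj_γ` (`toDual_T_smul`). The dual that is `Λ`-linearly
Poitou–Tate-dual to the covariant `𝐇¹` (home of the Coleman maps and of Sprung's `(L♯, L♭)`) is the CONTRAGREDIENT
one, key `γ⁻¹` (x8 referee R-228 / R-250, x8 lit T67, LEAD g5). The Literature dictionary
`Sprung2012/SharpFlatSelmerDualInvolutionTwistProofs.lean` (p660895): the two differ by the Iwasawa involution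
`ι = IwasawaAlgebra.invol p` and by nothing else — `char(D′.X) = ι(char(D.X))` for ANY `D` of key `γ`, ANY `D′`
of key `γ⁻¹`. This file turns that into statement-level doors (KEYING-g5 §1/§4, TRIAGE-r1-2 gen 29):

* §1 (pure `Λ`-algebra) the leaf's GENERATOR SHAPE «`I = (gen)`, `gen^ℚ = C ϖ · (L · h)^ℚ`» holds for `(I, L)`
  iff it holds for `(ι(I), ι L)` (`generatorShape_map_invol_iff`; `h`-free: `generatorEqShape_map_invol_iff`);
  `ι` fixes `ℚ_p`-constants and commutes with `Λ ↪ ℚ_p⟦T⟧` (`iwasawaToPowerSeries_invol`).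
* §2 for ANY `D` (key `γ`) and `D′` (key `γ⁻¹`): shape of `char D.X` w.r.t. `L` ⟺ shape of `char D′.X` w.r.t.
  `ι L` (`SharpFlatSelmerDualData.generatorShape_iff_contra`, …), and the `∀ D` / `∀ D′` forms.
* §3 THE LEAF DOORS (over `ℚ`, the leaf's binders word for word): **`sprungSharpFlatLowerDivisibility_iff_contra_invol`**
  — the typed leaf is EQUIVALENT to «for every CONTRAGREDIENT `D′ : SharpFlatSelmerDualData W κ γ⁻¹ …`,
  `char D′.X = (gen)`, `gen^ℚ = ϖ · (ι(L^•) · h)^ℚ`»: the typed K1 leaf asserts divisibility of the print dual's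
  characteristic power series by `ϖ · ι(L^•)`, NOT by `ϖ · L^•` (KEYING-g5 §1, now a kernel theorem);
  **`sprungSharpFlatLowerDivisibility_contra_iff_invol`** — the planners' repaired text C′ (the leaf over
  `γ⁻¹`-keyed `D′`) is EQUIVALENT to the typed text with `ι(L^•)` for `L^•`; main-conjecture twin
  `sprungSharpFlatMainConjecture_iff_contra_invol`. Typed crux vs C′ differ by EXACTLY
  `L^• ↔ ι(L^•)` — a unit for Kobayashi's `L^±` (`a_p = 0`), not for Sprung's `L♯/L♭` at `a_p ≠ 0`, where `ι`
  swaps private zeros between the colours (`ChromaticIota.ClassX8.mem_and_mem_iff_sharp_iotaPair`).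

References: Sprung, JNT 132 (2012) Def. 7.11, Main Conj. 7.21, §2 p. 1486 [Sprung2012]; Greenberg, LNM 1716 §1
p. 60 [GreenbergLNM1716]; Mazur–Tate–Teitelbaum, Invent. Math. 84 (1986) Ch. I §17 [MazurTateTeitelbaum1986Invent].
-/

set_option linter.dupNamespace false
set_option autoImplicit false

noncomputable section

open scoped Classical NumberField MatrixGroups ModularForm

open NumberField IsDedekindDomain CongruenceSubgroup WeierstrassCurve PowerSeries
  Literature.NumberTheory.EllipticCurves Literature.NumberTheory.EllipticCurves.ModularForms
  Literature.NumberTheory.EllipticCurves.ZpExtension Literature.NumberTheory.EllipticCurves.Sprung2017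
  Literature.NumberTheory.EllipticCurves.Sprung2012 Literature.NumberTheory.EllipticCurves.IwasawaAlgebra
  Literature.Barriers.BirchSwinnertonDyer

namespace Summit.BirchSwinnertonDyer.BirchSwinnertonDyer.Theorems

namespace ChromaticKeying

universe u

/-! ## §1 `Λ`-algebra: the leaf's generator shape is `ι`-covariant -/

section Algebra

variable {p : ℕ} [Fact p.Prime]

/-- `ι` commutes with the coefficient embedding `Λ ↪ ℚ_p⟦T⟧`: `(ι f)^ℚ = (f^ℚ)(T^ι)` for the NAMED involution
`IwasawaAlgebra.invol p` (tree: `invol p f = f.subst invOnePlusSubOne`, `SignedKatoOffTwo.Invol.invol_eq_subst_invOnePlusSubOne`,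
and `iwasawaToPowerSeries_subst_invOnePlusSubOne`). [cite: MazurTateTeitelbaum1986Invent, Ch. I §17] -/
theorem iwasawaToPowerSeries_invol (f : IwasawaAlgebra p) :
    iwasawaToPowerSeries p (invol p f) =
      (iwasawaToPowerSeries p f).subst (invOnePlusSubOne : ℚ_[p]⟦X⟧) := by
  rw [SignedKatoOffTwo.Invol.invol_eq_subst_invOnePlusSubOne, iwasawaToPowerSeries_subst_invOnePlusSubOne]

/-- `ι` of a principal ideal: `ι((g)) = (ι g)`. [cite: GreenbergLNM1716, §1 (p. 60)] -/
theorem map_invol_span_singleton (g : IwasawaAlgebra p) :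
    (Ideal.span {g}).map (invol p).toRingHom = Ideal.span {invol p g} := by
  rw [Ideal.map_span, Set.image_singleton]
  rfl

/-- `ι(ι(I)) = I` for ideals of `Λ`. [cite: GreenbergLNM1716, §1 (p. 60)] -/
theorem map_invol_map_invol (I : Ideal (IwasawaAlgebra p)) :
    (I.map (invol p).toRingHom).map (invol p).toRingHom = I := by
  have hcomp : (invol p).toRingHom.comp (invol p).toRingHom = RingHom.id (IwasawaAlgebra p) :=
    RingHom.ext fun f ↦ invol_invol p f
  rw [Ideal.map_map, hcomp, Ideal.map_id]

/-- `ι` applied to the leaf's `ℚ_p⟦T⟧`-identity: from `gen^ℚ = C ϖ · (L · h)^ℚ` follows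
`(ι gen)^ℚ = C ϖ · (ι L · ι h)^ℚ` (`ι` is a ring map commuting with `Λ ↪ ℚ_p⟦T⟧` and fixing constants).
[cite: MazurTateTeitelbaum1986Invent, Ch. I §17] -/
theorem iwasawaToPowerSeries_invol_eq_of_eq (ϖ : ℚ_[p]) {gen L h : IwasawaAlgebra p}
    (hgen : iwasawaToPowerSeries p gen = PowerSeries.C ϖ * iwasawaToPowerSeries p (L * h)) :
    iwasawaToPowerSeries p (invol p gen) =
      PowerSeries.C ϖ * iwasawaToPowerSeries p (invol p L * invol p h) := by
  have hC : (PowerSeries.C ϖ : ℚ_[p]⟦X⟧).subst (invOnePlusSubOne : ℚ_[p]⟦X⟧) = PowerSeries.C ϖ :=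
    subst_C ϖ
  rw [← map_mul (invol p), iwasawaToPowerSeries_invol, iwasawaToPowerSeries_invol, hgen,
    subst_mul hasSubst_invOnePlusSubOne, hC]

/-- The `h`-free form: from `gen^ℚ = C ϖ · L^ℚ` follows `(ι gen)^ℚ = C ϖ · (ι L)^ℚ`.
[cite: MazurTateTeitelbaum1986Invent, Ch. I §17] -/
theorem iwasawaToPowerSeries_invol_eq_of_eq' (ϖ : ℚ_[p]) {gen L : IwasawaAlgebra p}
    (hgen : iwasawaToPowerSeries p gen = PowerSeries.C ϖ * iwasawaToPowerSeries p L) :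
    iwasawaToPowerSeries p (invol p gen) = PowerSeries.C ϖ * iwasawaToPowerSeries p (invol p L) := by
  have h1 : iwasawaToPowerSeries p gen = PowerSeries.C ϖ * iwasawaToPowerSeries p (L * 1) := by
    rw [mul_one]; exact hgen
  have h2 := iwasawaToPowerSeries_invol_eq_of_eq ϖ h1
  rwa [map_one, mul_one] at h2

/-- One direction of the `ι`-covariance of the leaf's GENERATOR SHAPE: if `I = (gen)` with
`gen^ℚ = C ϖ · (L · h)^ℚ` then `ι(I) = (ι gen)` with `(ι gen)^ℚ = C ϖ · (ι L · ι h)^ℚ`.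
[cite: GreenbergLNM1716, §1 (p. 60)] [cite: MazurTateTeitelbaum1986Invent, Ch. I §17] -/
theorem generatorShape_map_invol_of_generatorShape (ϖ : ℚ_[p]) (L : IwasawaAlgebra p)
    (I : Ideal (IwasawaAlgebra p))
    (hI : ∃ gen h : IwasawaAlgebra p, I = Ideal.span {gen} ∧
      iwasawaToPowerSeries p gen = PowerSeries.C ϖ * iwasawaToPowerSeries p (L * h)) :
    ∃ gen h : IwasawaAlgebra p, I.map (invol p).toRingHom = Ideal.span {gen} ∧
      iwasawaToPowerSeries p gen = PowerSeries.C ϖ * iwasawaToPowerSeries p (invol p L * h) := by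
  obtain ⟨gen, h, hIgen, hgen⟩ := hI
  exact ⟨invol p gen, invol p h, by rw [hIgen, map_invol_span_singleton],
    iwasawaToPowerSeries_invol_eq_of_eq ϖ hgen⟩

/-- **The leaf's generator shape is `ι`-covariant**: «`I = (gen)`, `gen^ℚ = C ϖ · (L · h)^ℚ` for some
`gen, h`» holds for `(I, L)` iff it holds for `(ι(I), ι L)`. [cite: GreenbergLNM1716, §1 (p. 60)]
[cite: MazurTateTeitelbaum1986Invent, Ch. I §17] -/
theorem generatorShape_map_invol_iff (ϖ : ℚ_[p]) (L : IwasawaAlgebra p) (I : Ideal (IwasawaAlgebra p)) :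
    (∃ gen h : IwasawaAlgebra p, I = Ideal.span {gen} ∧
      iwasawaToPowerSeries p gen = PowerSeries.C ϖ * iwasawaToPowerSeries p (L * h)) ↔
    (∃ gen h : IwasawaAlgebra p, I.map (invol p).toRingHom = Ideal.span {gen} ∧
      iwasawaToPowerSeries p gen = PowerSeries.C ϖ * iwasawaToPowerSeries p (invol p L * h)) := by
  refine ⟨generatorShape_map_invol_of_generatorShape ϖ L I, fun hI ↦ ?_⟩
  have h2 := generatorShape_map_invol_of_generatorShape ϖ (invol p L) (I.map (invol p).toRingHom) hI
  rwa [map_invol_map_invol, invol_invol] at h2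

/-- **The main conjecture's shape is `ι`-covariant**: «`I = (gen)`, `gen^ℚ = C ϖ · L^ℚ` for some `gen`» holds
for `(I, L)` iff it holds for `(ι(I), ι L)`. [cite: GreenbergLNM1716, §1 (p. 60)]
[cite: MazurTateTeitelbaum1986Invent, Ch. I §17] -/
theorem generatorEqShape_map_invol_iff (ϖ : ℚ_[p]) (L : IwasawaAlgebra p) (I : Ideal (IwasawaAlgebra p)) :
    (∃ gen : IwasawaAlgebra p, I = Ideal.span {gen} ∧
      iwasawaToPowerSeries p gen = PowerSeries.C ϖ * iwasawaToPowerSeries p L) ↔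
    (∃ gen : IwasawaAlgebra p, I.map (invol p).toRingHom = Ideal.span {gen} ∧
      iwasawaToPowerSeries p gen = PowerSeries.C ϖ * iwasawaToPowerSeries p (invol p L)) := by
  have one : ∀ (L' : IwasawaAlgebra p) (J : Ideal (IwasawaAlgebra p)),
      (∃ gen : IwasawaAlgebra p, J = Ideal.span {gen} ∧
        iwasawaToPowerSeries p gen = PowerSeries.C ϖ * iwasawaToPowerSeries p L') →
      (∃ gen : IwasawaAlgebra p, J.map (invol p).toRingHom = Ideal.span {gen} ∧
        iwasawaToPowerSeries p gen = PowerSeries.C ϖ * iwasawaToPowerSeries p (invol p L')) := by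
    rintro L' J ⟨gen, hJ, hgen⟩
    exact ⟨invol p gen, by rw [hJ, map_invol_span_singleton], iwasawaToPowerSeries_invol_eq_of_eq' ϖ hgen⟩
  refine ⟨one L I, fun hI ↦ ?_⟩
  have h2 := one (invol p L) (I.map (invol p).toRingHom) hI
  rwa [map_invol_map_invol, invol_invol] at h2

end Algebra

/-! ## §2 The doors between a key-`γ` datum and a key-`γ⁻¹` datum -/

section Data

variable {K : Type u} [Field K] [NumberField K] {W : WeierstrassCurve K} {p : ℕ} [Fact p.Prime]
  {κ : ZpExtension K p} {E : Type u} [Field E] [Algebra K E]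
  {ιv : AlgebraicClosure K →ₐ[K] AlgebraicClosure E} {ap : ℤ} {g : Field.absoluteGaloisGroup E}
  {c : ℕ → localPoints W E} {col : Chroma} {γ : Field.absoluteGaloisGroup K}

/-- **The generator-shape door** between ANY tree-keyed `D : SharpFlatSelmerDualData W κ γ …` and ANY
contragredient `D′ : SharpFlatSelmerDualData W κ γ⁻¹ …`: «`char D.X = (gen)`, `gen^ℚ = C ϖ · (L · h)^ℚ`»
⟺ «`char D′.X = (gen′)`, `gen′^ℚ = C ϖ · (ι L · h′)^ℚ`» (`char D′.X = ι(char D.X)`,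
`sharpFlatSelmerDualData_charIdeal_inv_eq`, and §1). [cite: GreenbergLNM1716, §1 (p. 60)] [cite: Sprung2012, Def. 7.11 (p. 1503)] -/
theorem SharpFlatSelmerDualData.generatorShape_iff_contra (D : SharpFlatSelmerDualData W κ γ ιv ap g c col)
    (D' : SharpFlatSelmerDualData W κ γ⁻¹ ιv ap g c col) (ϖ : ℚ_[p]) (L : IwasawaAlgebra p) :
    (∃ gen h : IwasawaAlgebra p, D.charIdeal = Ideal.span {gen} ∧
      iwasawaToPowerSeries p gen = PowerSeries.C ϖ * iwasawaToPowerSeries p (L * h)) ↔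
    (∃ gen h : IwasawaAlgebra p, D'.charIdeal = Ideal.span {gen} ∧
      iwasawaToPowerSeries p gen = PowerSeries.C ϖ * iwasawaToPowerSeries p (invol p L * h)) := by
  rw [sharpFlatSelmerDualData_charIdeal_inv_eq D D']
  exact generatorShape_map_invol_iff ϖ L D.charIdeal

/-- The same door read from the contragredient side: «`char D′.X = (gen′)`, `gen′^ℚ = C ϖ · (L · h′)^ℚ`»
⟺ «`char D.X = (gen)`, `gen^ℚ = C ϖ · (ι L · h)^ℚ`». [cite: GreenbergLNM1716, §1 (p. 60)] -/
theorem SharpFlatSelmerDualData.generatorShape_contra_iff (D : SharpFlatSelmerDualData W κ γ ιv ap g c col)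
    (D' : SharpFlatSelmerDualData W κ γ⁻¹ ιv ap g c col) (ϖ : ℚ_[p]) (L : IwasawaAlgebra p) :
    (∃ gen h : IwasawaAlgebra p, D'.charIdeal = Ideal.span {gen} ∧
      iwasawaToPowerSeries p gen = PowerSeries.C ϖ * iwasawaToPowerSeries p (L * h)) ↔
    (∃ gen h : IwasawaAlgebra p, D.charIdeal = Ideal.span {gen} ∧
      iwasawaToPowerSeries p gen = PowerSeries.C ϖ * iwasawaToPowerSeries p (invol p L * h)) := by
  rw [SharpFlatSelmerDualData.generatorShape_iff_contra D D' ϖ (invol p L), invol_invol]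

/-- **The main-conjecture-shape door** (`h`-free): «`char D.X = (gen)`, `gen^ℚ = C ϖ · L^ℚ`» ⟺
«`char D′.X = (gen′)`, `gen′^ℚ = C ϖ · (ι L)^ℚ`». [cite: GreenbergLNM1716, §1 (p. 60)] [cite: Sprung2012, Main Conj. 7.21 (p. 1505) (the shape only)] -/
theorem SharpFlatSelmerDualData.generatorEqShape_iff_contra (D : SharpFlatSelmerDualData W κ γ ιv ap g c col)
    (D' : SharpFlatSelmerDualData W κ γ⁻¹ ιv ap g c col) (ϖ : ℚ_[p]) (L : IwasawaAlgebra p) :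
    (∃ gen : IwasawaAlgebra p, D.charIdeal = Ideal.span {gen} ∧
      iwasawaToPowerSeries p gen = PowerSeries.C ϖ * iwasawaToPowerSeries p L) ↔
    (∃ gen : IwasawaAlgebra p, D'.charIdeal = Ideal.span {gen} ∧
      iwasawaToPowerSeries p gen = PowerSeries.C ϖ * iwasawaToPowerSeries p (invol p L)) := by
  rw [sharpFlatSelmerDualData_charIdeal_inv_eq D D']
  exact generatorEqShape_map_invol_iff ϖ L D.charIdeal

/-- `∀`-form of the generator-shape door: «every key-`γ` datum has the shape w.r.t. `L`» ⟺ «every key-`γ⁻¹`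
datum has the shape w.r.t. `ι L`» (twist a given datum to the other key, `sharpFlatSelmerDualData_exists_involTwist`,
then use the door). [cite: GreenbergLNM1716, §1 (p. 60)] -/
theorem forall_generatorShape_iff_forall_contra (ϖ : ℚ_[p]) (L : IwasawaAlgebra p) :
    (∀ D : SharpFlatSelmerDualData W κ γ ιv ap g c col, ∃ gen h : IwasawaAlgebra p,
      D.charIdeal = Ideal.span {gen} ∧
        iwasawaToPowerSeries p gen = PowerSeries.C ϖ * iwasawaToPowerSeries p (L * h)) ↔
    (∀ D' : SharpFlatSelmerDualData W κ γ⁻¹ ιv ap g c col, ∃ gen h : IwasawaAlgebra p,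
      D'.charIdeal = Ideal.span {gen} ∧
        iwasawaToPowerSeries p gen = PowerSeries.C ϖ * iwasawaToPowerSeries p (invol p L * h)) := by
  refine ⟨fun hD D' ↦ ?_, fun hD' D ↦ ?_⟩
  · obtain ⟨D, -, -, -⟩ := sharpFlatSelmerDualData_exists_involTwist (inv_mul_cancel γ) D'
    exact (SharpFlatSelmerDualData.generatorShape_iff_contra D D' ϖ L).1 (hD D)
  · obtain ⟨D', -, -, -⟩ := sharpFlatSelmerDualData_exists_involTwist (mul_inv_cancel γ) D
    exact (SharpFlatSelmerDualData.generatorShape_iff_contra D D' ϖ L).2 (hD' D')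

/-- `∀`-form read from the contragredient side: «every key-`γ⁻¹` datum has the shape w.r.t. `L`» ⟺ «every
key-`γ` datum has the shape w.r.t. `ι L`». [cite: GreenbergLNM1716, §1 (p. 60)] -/
theorem forall_generatorShape_contra_iff_forall (ϖ : ℚ_[p]) (L : IwasawaAlgebra p) :
    (∀ D' : SharpFlatSelmerDualData W κ γ⁻¹ ιv ap g c col, ∃ gen h : IwasawaAlgebra p,
      D'.charIdeal = Ideal.span {gen} ∧
        iwasawaToPowerSeries p gen = PowerSeries.C ϖ * iwasawaToPowerSeries p (L * h)) ↔
    (∀ D : SharpFlatSelmerDualData W κ γ ιv ap g c col, ∃ gen h : IwasawaAlgebra p,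
      D.charIdeal = Ideal.span {gen} ∧
        iwasawaToPowerSeries p gen = PowerSeries.C ϖ * iwasawaToPowerSeries p (invol p L * h)) := by
  rw [forall_generatorShape_iff_forall_contra ϖ (invol p L), invol_invol]

/-- `∀`-form of the main-conjecture door, torsion clause included: «every key-`γ` datum is torsion with
`char = (gen)`, `gen^ℚ = C ϖ · L^ℚ`» ⟺ «every key-`γ⁻¹` datum is torsion with `char = (gen′)`,
`gen′^ℚ = C ϖ · (ι L)^ℚ`» (`sharpFlatSelmerDualData_isTorsion_inv_iff`). [cite: GreenbergLNM1716, §1 (p. 60)] -/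
theorem forall_torsion_generatorEqShape_iff_forall_contra (ϖ : ℚ_[p]) (L : IwasawaAlgebra p) :
    (∀ D : SharpFlatSelmerDualData W κ γ ιv ap g c col,
      Module.IsTorsion (IwasawaAlgebra p) D.X ∧ ∃ gen : IwasawaAlgebra p,
        D.charIdeal = Ideal.span {gen} ∧
          iwasawaToPowerSeries p gen = PowerSeries.C ϖ * iwasawaToPowerSeries p L) ↔
    (∀ D' : SharpFlatSelmerDualData W κ γ⁻¹ ιv ap g c col,
      Module.IsTorsion (IwasawaAlgebra p) D'.X ∧ ∃ gen : IwasawaAlgebra p,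
        D'.charIdeal = Ideal.span {gen} ∧
          iwasawaToPowerSeries p gen = PowerSeries.C ϖ * iwasawaToPowerSeries p (invol p L)) := by
  refine ⟨fun hD D' ↦ ?_, fun hD' D ↦ ?_⟩
  · obtain ⟨D, -, -, -⟩ := sharpFlatSelmerDualData_exists_involTwist (inv_mul_cancel γ) D'
    obtain ⟨htor, hshape⟩ := hD D
    exact ⟨(sharpFlatSelmerDualData_isTorsion_inv_iff D D').1 htor,
      (SharpFlatSelmerDualData.generatorEqShape_iff_contra D D' ϖ L).1 hshape⟩
  · obtain ⟨D', -, -, -⟩ := sharpFlatSelmerDualData_exists_involTwist (mul_inv_cancel γ) D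
    obtain ⟨htor, hshape⟩ := hD' D'
    exact ⟨(sharpFlatSelmerDualData_isTorsion_inv_iff D D').2 htor,
      (SharpFlatSelmerDualData.generatorEqShape_iff_contra D D' ϖ L).2 hshape⟩

end Data

/-! ## §3 The leaf doors over `ℚ` (binders of `Theorems.SprungSharpFlatLowerDivisibility` word for word) -/

section Leaf

variable (W : WeierstrassCurve ℚ) [W.IsElliptic] [W.IsGloballyMinimal] (p : ℕ) [Fact p.Prime] (col : Chroma)

/-- **KEYING DOOR FOR THE K1 LEAF (typed ⟹/⟸ contragredient-with-ι).** The typed leaf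
`Theorems.SprungSharpFlatLowerDivisibility W p •` (dual keyed at `γ`) is EQUIVALENT to the same text over the
CONTRAGREDIENT duals `D′ : SharpFlatSelmerDualData W κ γ⁻¹ …` with `ι(L^•)` in place of `L^•`:
`char D′.X = (gen)`, `gen^ℚ = ϖ · (ι(chromaticL • L♯ L♭) · h)^ℚ`. In words: what the typed K1 leaf asserts about
the print-keyed `X^•` is divisibility of its characteristic power series by `ϖ · ι(L^•)` (KEYING-g5 §1), not by
`ϖ · L^•` (Sprung's Main Conj. 7.21 ⊆). No fact is used. [cite: Sprung2012, Main Conj. 7.21 (p. 1505) and Def. 7.11 (p. 1503) (the objects only)]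
[cite: GreenbergLNM1716, §1 (p. 60)] -/
theorem sprungSharpFlatLowerDivisibility_iff_contra_invol :
    SprungSharpFlatLowerDivisibility W p col ↔
    ∀ (κ : ZpExtension ℚ p) (γ : Field.absoluteGaloisGroup ℚ),
        κ.IsCyclotomic → κ.IsTopGenerator γ → IsCyclotomicVariable p γ →
      ∀ (v : HeightOneSpectrum (𝓞 ℚ)), (p : 𝓞 ℚ) ∈ v.asIdeal →
      ∀ (g : Field.absoluteGaloisGroup (v.adicCompletion ℚ)),
        κ.IsTopGenerator (resGalOfEmb (closureEmb (K := ℚ) (v.adicCompletion ℚ)) g) →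
      ∀ (cneg : localPoints W (v.adicCompletion ℚ)) (c : ℕ → localPoints W (v.adicCompletion ℚ)),
        IsHondaSystem κ (closureEmb (K := ℚ) (v.adicCompletion ℚ)) W (W.frobeniusTrace p) g cneg c →
      ∀ (N : ℕ) (_ : NeZero N) (f : CuspForm (Gamma0 N) 2) (ϖ : ℚ) (Lsharp Lflat : IwasawaAlgebra p),
        IsNewformOf W f → (ϖ : ℝ) * W.realPeriodRat = plusPeriod f →
        IsSprungPair f p (W.frobeniusTrace p) Lsharp Lflat → chromaticL col Lsharp Lflat ≠ 0 →
      ∀ D' : SharpFlatSelmerDualData W κ γ⁻¹ (closureEmb (K := ℚ) (v.adicCompletion ℚ))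
          (W.frobeniusTrace p) g c col,
        ∃ gen h : IwasawaAlgebra p, D'.charIdeal = Ideal.span {gen} ∧
          iwasawaToPowerSeries p gen =
            PowerSeries.C (ϖ : ℚ_[p]) *
              iwasawaToPowerSeries p (invol p (chromaticL col Lsharp Lflat) * h) := by
  unfold SprungSharpFlatLowerDivisibility
  iterate 22 refine forall_congr' fun _ ↦ ?_
  exact forall_generatorShape_iff_forall_contra _ _

omit [W.IsElliptic] in
/-- **KEYING DOOR FOR THE REPAIRED LEAF C′**: the planners' repaired text (the leaf over CONTRAGREDIENT duals
`D′ : SharpFlatSelmerDualData W κ γ⁻¹ …`, `L^•` itself = Main Conj. 7.21 ⊆ in the natural keying; LEAD g5 /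
TRIAGE-r1-2 gen 29 / R-250 §4) ⟺ the typed leaf's own text (key `γ`) with `ι(L^•)` in place of `L^•`. No fact used.
[cite: Sprung2012, Main Conj. 7.21 (p. 1505) and Def. 7.11 (p. 1503) (the objects only)] [cite: GreenbergLNM1716, §1 (p. 60)] -/
theorem sprungSharpFlatLowerDivisibility_contra_iff_invol :
    (∀ (κ : ZpExtension ℚ p) (γ : Field.absoluteGaloisGroup ℚ),
        κ.IsCyclotomic → κ.IsTopGenerator γ → IsCyclotomicVariable p γ →
      ∀ (v : HeightOneSpectrum (𝓞 ℚ)), (p : 𝓞 ℚ) ∈ v.asIdeal →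
      ∀ (g : Field.absoluteGaloisGroup (v.adicCompletion ℚ)),
        κ.IsTopGenerator (resGalOfEmb (closureEmb (K := ℚ) (v.adicCompletion ℚ)) g) →
      ∀ (cneg : localPoints W (v.adicCompletion ℚ)) (c : ℕ → localPoints W (v.adicCompletion ℚ)),
        IsHondaSystem κ (closureEmb (K := ℚ) (v.adicCompletion ℚ)) W (W.frobeniusTrace p) g cneg c →
      ∀ (N : ℕ) (_ : NeZero N) (f : CuspForm (Gamma0 N) 2) (ϖ : ℚ) (Lsharp Lflat : IwasawaAlgebra p),
        IsNewformOf W f → (ϖ : ℝ) * W.realPeriodRat = plusPeriod f →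
        IsSprungPair f p (W.frobeniusTrace p) Lsharp Lflat → chromaticL col Lsharp Lflat ≠ 0 →
      ∀ D' : SharpFlatSelmerDualData W κ γ⁻¹ (closureEmb (K := ℚ) (v.adicCompletion ℚ))
          (W.frobeniusTrace p) g c col,
        ∃ gen h : IwasawaAlgebra p, D'.charIdeal = Ideal.span {gen} ∧
          iwasawaToPowerSeries p gen =
            PowerSeries.C (ϖ : ℚ_[p]) * iwasawaToPowerSeries p (chromaticL col Lsharp Lflat * h)) ↔
    ∀ (κ : ZpExtension ℚ p) (γ : Field.absoluteGaloisGroup ℚ),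
        κ.IsCyclotomic → κ.IsTopGenerator γ → IsCyclotomicVariable p γ →
      ∀ (v : HeightOneSpectrum (𝓞 ℚ)), (p : 𝓞 ℚ) ∈ v.asIdeal →
      ∀ (g : Field.absoluteGaloisGroup (v.adicCompletion ℚ)),
        κ.IsTopGenerator (resGalOfEmb (closureEmb (K := ℚ) (v.adicCompletion ℚ)) g) →
      ∀ (cneg : localPoints W (v.adicCompletion ℚ)) (c : ℕ → localPoints W (v.adicCompletion ℚ)),
        IsHondaSystem κ (closureEmb (K := ℚ) (v.adicCompletion ℚ)) W (W.frobeniusTrace p) g cneg c →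
      ∀ (N : ℕ) (_ : NeZero N) (f : CuspForm (Gamma0 N) 2) (ϖ : ℚ) (Lsharp Lflat : IwasawaAlgebra p),
        IsNewformOf W f → (ϖ : ℝ) * W.realPeriodRat = plusPeriod f →
        IsSprungPair f p (W.frobeniusTrace p) Lsharp Lflat → chromaticL col Lsharp Lflat ≠ 0 →
      ∀ D : SharpFlatSelmerDualData W κ γ (closureEmb (K := ℚ) (v.adicCompletion ℚ))
          (W.frobeniusTrace p) g c col,
        ∃ gen h : IwasawaAlgebra p, D.charIdeal = Ideal.span {gen} ∧
          iwasawaToPowerSeries p gen =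
            PowerSeries.C (ϖ : ℚ_[p]) *
              iwasawaToPowerSeries p (invol p (chromaticL col Lsharp Lflat) * h) := by
  iterate 22 refine forall_congr' fun _ ↦ ?_
  exact forall_generatorShape_contra_iff_forall _ _

/-- **KEYING DOOR FOR THE MAIN-CONJECTURE LEAF**: `Theorems.SprungSharpFlatMainConjecture W p •` (key `γ`)
⟺ for every CONTRAGREDIENT `D′` (key `γ⁻¹`), `D′.X` is torsion and `char D′.X = (gen)`, `gen^ℚ = ϖ · (ι(L^•))^ℚ`
— generated by `ϖ · ι(L^•)`, not `ϖ · L^•`. No fact used.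
[cite: Sprung2012, Main Conj. 7.21 (p. 1505) and Def. 7.11 (p. 1503) (the objects only)] [cite: GreenbergLNM1716, §1 (p. 60)] -/
theorem sprungSharpFlatMainConjecture_iff_contra_invol :
    SprungSharpFlatMainConjecture W p col ↔
    ∀ (κ : ZpExtension ℚ p) (γ : Field.absoluteGaloisGroup ℚ),
        κ.IsCyclotomic → κ.IsTopGenerator γ → IsCyclotomicVariable p γ →
      ∀ (v : HeightOneSpectrum (𝓞 ℚ)), (p : 𝓞 ℚ) ∈ v.asIdeal →
      ∀ (g : Field.absoluteGaloisGroup (v.adicCompletion ℚ)),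
        κ.IsTopGenerator (resGalOfEmb (closureEmb (K := ℚ) (v.adicCompletion ℚ)) g) →
      ∀ (cneg : localPoints W (v.adicCompletion ℚ)) (c : ℕ → localPoints W (v.adicCompletion ℚ)),
        IsHondaSystem κ (closureEmb (K := ℚ) (v.adicCompletion ℚ)) W (W.frobeniusTrace p) g cneg c →
      ∀ (N : ℕ) (_ : NeZero N) (f : CuspForm (Gamma0 N) 2) (ϖ : ℚ) (Lsharp Lflat : IwasawaAlgebra p),
        IsNewformOf W f → (ϖ : ℝ) * W.realPeriodRat = plusPeriod f →
        IsSprungPair f p (W.frobeniusTrace p) Lsharp Lflat → chromaticL col Lsharp Lflat ≠ 0 →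
      ∀ D' : SharpFlatSelmerDualData W κ γ⁻¹ (closureEmb (K := ℚ) (v.adicCompletion ℚ))
          (W.frobeniusTrace p) g c col,
        Module.IsTorsion (IwasawaAlgebra p) D'.X ∧
        ∃ gen : IwasawaAlgebra p, D'.charIdeal = Ideal.span {gen} ∧
          iwasawaToPowerSeries p gen =
            PowerSeries.C (ϖ : ℚ_[p]) * iwasawaToPowerSeries p (invol p (chromaticL col Lsharp Lflat)) := by
  unfold SprungSharpFlatMainConjecture
  iterate 22 refine forall_congr' fun _ ↦ ?_
  exact forall_torsion_generatorEqShape_iff_forall_contra _ _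

end Leaf

end ChromaticKeying

end Summit.BirchSwinnertonDyer.BirchSwinnertonDyer.Theorems

end
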